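import Summits.CriticalPhenomena.Ising3DConformalLimit.Theorems.HyperoctahedralRPExistsScaleCovariantLimitFoldedCurrentHankelCompleteMonotonicity
import Summits.CriticalPhenomena.Ising3DConformalLimit.Theorems.HyperoctahedralRPExistsScaleCovariantLimitFoldedCurrentAxisProfileFacts
import Summits.CriticalPhenomena.Ising3DConformalLimit.Theorems.HyperoctahedralRPInversionUpgradeNormalisedLatticeRP
import Summits.CriticalPhenomena.Ising3DConformalLimit.Theorems.CanonicalBranchRefutationIsingLimitHeritageBondMirrorRP
import Literature.Probability.LatticeModels.AxisSpectralRepresentationProofs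
import Literature.Probability.LatticeModels.HighDimPointwiseTriviality
import HarnessLib

/-!
# The critical axis two-point function of the `ℤ³` Ising model: complete monotonicity from the two
# mirror RPs, and the spectral clause of the axis-profile barrier discharged
# (crux `ExistsScaleCovariantLimit`, stmt-CriticalPhenomena-1981, line `folded-current-repulsion`, F2 record)

`g_i(n) = ⟨σ₀σ_{n e_i}⟩⁺_{β_c(3)} = criticalTwoPoint 3 (Pi.single i n)`.

§4. **Complete monotonicity, directly from reflection positivity** (registered sub-goal
`criticalAxis_completelyMonotone`): for every axis `i` and all `k, n`,
`0 ≤ Σ_{j=0}^{k} (-1)^j (k choose j) g_i(n + j)` — Hausdorff's condition at every order — from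
site-mirror RP (`stub_latticeRP`, FILS 1978 §2: the Hankel form `Σ c_a c_b g(a+b)` is psd,
`criticalAxis_hankel_zero_nonneg`), bond-mirror RP (`stub_bondMirrorRP`: so is `Σ c_a c_b g(a+b+1)`,
`criticalAxis_hankel_one_nonneg`) and `0 ≤ g ≤ 1`, fed into the finitary abstract core
`HankelMoment.completelyMonotone_of_hankel_psd` (p153968); also the domination
`Σ c_a c_b g(a+b+1) ≤ Σ c_a c_b g(a+b)` ("`0 ≤ T ≤ 1`", `criticalAxis_hankel_one_le_zero`).
NOTE: the tree ALSO holds the full spectral representation of the axis profile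
(`AizenmanDuminilCopin2021_prop_8_6_holds`, `Literature/…/AxisSpectralRepresentationProofs.lean`,
ADC21 App. Prop. 8.6 with the atom at `e^{-a} = 0` excluded), from which these inequalities also
follow by integrating `λⁿ(1−λ)^k ≥ 0`; §4 is the measure-free route and records the two Hankel
positivity facts by name.

§5. **The spectral clause of the barrier, discharged** (registered sub-goal
`hasAxisSpectralRepresentation_criticalAxis`): the critical axis profile satisfies
`Literature.Barriers.CriticalPhenomena.HasAxisSpectralRepresentation` (from
`AizenmanDuminilCopin2021_prop_8_6_holds` at `d = 3`, `β = β_c`, `m*(β_c) = 0`, `β_c > 0`). Hence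
lead c16's barrier companion loses its side hypothesis: at the Ising profile the instance of the
REFUTED technique class `AxisProfileDoublingFor` (p149925: `not_forall_axisProfileDoublingFor`) is
LITERALLY item 6150 — `axisProfileDoublingFor_criticalAxis_iff : AxisProfileDoublingFor g₀ ↔ TwoPointDoubling`
(both hypotheses of the class, `AxisProfileFacts g₀` (p151247) and the spectral representation, hold
for the true profile). Reading: every one of the axis-profile facts AND the Källén–Lehmann
representation are in the tree by name for `g₀`, and 6150 is exactly what the refuted uniform
implication would add — the record of "what two-point axis structure gives" is complete and closed.

References: J. Fröhlich, R. Israel, E. H. Lieb, B. Simon, Comm. Math. Phys. 62 (1978) 1–34, §2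
[FrohlichIsraelLiebSimon1978]; M. Aizenman, H. Duminil-Copin, Ann. of Math. 194 (2021),
arXiv:1912.07973, Prop. 5.3 (5.17), App. A.3 Prop. 8.6, Remark 5.10 [AizenmanDuminilCopinAnnals2021];
C. Berg, J. P. R. Christensen, P. Ressel, *Harmonic Analysis on Semigroups* (1984), Ch. 4 §6
[BergChristensenRessel1984].
-/

noncomputable section

open Finset
open scoped BigOperators
open Literature.Probability.LatticeModels Literature.Barriers.CriticalPhenomena

namespace Summit.CriticalPhenomena.Ising3DConformalLimit.Cruxes.ExistsScaleCovariantLimit.FoldedCurrentRepulsion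


/-! ### 4. The Ising instance: site- and bond-mirror RP give the two Hankel forms -/

/-- A pair monomial of the RP stubs is a two-point function:
`⟨σ_u σ_v⟩_{β_c} = criticalTwoPoint 3 (v − u)`. [folklore] -/
theorem criticalCorr_append_pair (u v : Site 3) :
    criticalCorr 3 (1 + 1) (Fin.append (fun _ : Fin 1 => u) (fun _ : Fin 1 => v)) =
      criticalTwoPoint 3 (v - u) := by
  rw [← criticalCorr_two_pair u v]
  congr 1
  funext i
  fin_cases i
  · exact Fin.append_left (fun _ : Fin 1 => u) (fun _ : Fin 1 => v) 0
  · exact Fin.append_right (fun _ : Fin 1 => u) (fun _ : Fin 1 => v) 0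

/-- **`H₀ ⪰ 0` for the critical axis profile** (site-mirror RP, plane `{x_i = 0}`):
`0 ≤ Σ_{a,b<m} c_a c_b ⟨σ₀σ_{(a+b)e_i}⟩_{β_c}`. [cite: FrohlichIsraelLiebSimon1978, §2] -/
theorem criticalAxis_hankel_zero_nonneg (i : Fin 3) (m : ℕ) (c : Fin m → ℝ) :
    0 ≤ ∑ a, ∑ b, c a * c b * criticalTwoPoint 3 (Pi.single i (((a : ℕ) + (b : ℕ) : ℕ) : ℤ)) := by
  have h := Cruxes.InversionUpgradeNormalised.FreeEndpointGaussianClosure.stub_latticeRP i m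
    (fun _ => 1) (fun a _ => Pi.single i ((a : ℕ) : ℤ)) c (fun a _ => by simp)
  refine h.trans_eq (Finset.sum_congr rfl fun a _ => Finset.sum_congr rfl fun b _ => ?_)
  congr 1
  have hu : (fun j : Fin 1 => Function.update (Pi.single i ((a : ℕ) : ℤ) : Site 3) i
      (-(Pi.single i ((a : ℕ) : ℤ) : Site 3) i)) = fun _ : Fin 1 => (Pi.single i (-((a : ℕ) : ℤ)) : Site 3) := by
    funext j x
    simp only [Function.update_apply, Pi.single_apply]
    split_ifs <;> simp
  rw [hu, criticalCorr_append_pair]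
  congr 1
  rw [← Pi.single_sub]
  congr 1
  push_cast
  ring

/-- **`H₁ ⪰ 0` for the critical axis profile** (bond-mirror RP, plane `{x_i = −1/2}`):
`0 ≤ Σ_{a,b<m} c_a c_b ⟨σ₀σ_{(a+b+1)e_i}⟩_{β_c}`. [cite: FrohlichIsraelLiebSimon1978, §2] -/
theorem criticalAxis_hankel_one_nonneg (i : Fin 3) (m : ℕ) (c : Fin m → ℝ) :
    0 ≤ ∑ a, ∑ b, c a * c b * criticalTwoPoint 3 (Pi.single i (((a : ℕ) + (b : ℕ) + 1 : ℕ) : ℤ)) := by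
  have h := Cruxes.IsingLimitHeritage.Birth.stub_bondMirrorRP i m
    (fun _ => 1) (fun a _ => Pi.single i ((a : ℕ) : ℤ)) c (fun a _ => by simp)
  refine h.trans_eq (Finset.sum_congr rfl fun a _ => Finset.sum_congr rfl fun b _ => ?_)
  congr 1
  have hu : (fun j : Fin 1 => Function.update (Pi.single i ((a : ℕ) : ℤ) : Site 3) i
      (-1 - (Pi.single i ((a : ℕ) : ℤ) : Site 3) i)) = fun _ : Fin 1 => (Pi.single i (-1 - ((a : ℕ) : ℤ)) : Site 3) := by
    funext j x
    simp only [Function.update_apply, Pi.single_apply]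
    split_ifs <;> simp
  rw [hu, criticalCorr_append_pair]
  congr 1
  rw [← Pi.single_sub]
  congr 1
  push_cast
  ring

/-- **THE CRITICAL AXIS TWO-POINT FUNCTION OF THE `ℤ³` ISING MODEL IS COMPLETELY MONOTONE**
(registered sub-goal `criticalAxis_completelyMonotone` of crux stmt-CriticalPhenomena-1981, F2 record):
for every axis `i` and all `k, n`,
`0 ≤ Σ_{j=0}^{k} (-1)^j (k choose j) ⟨σ₀σ_{(n+j)e_i}⟩_{β_c}`, i.e. `(-1)^k Δ^k g_i ≥ 0` at every order —
from site-mirror RP (`H₀ ⪰ 0`), bond-mirror RP (`H₁ ⪰ 0`) and `0 ≤ g ≤ 1`, by the finitary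
Hausdorff argument of `HankelMoment.completelyMonotone_of_hankel_psd`.
[cite: FrohlichIsraelLiebSimon1978, §2] [cite: AizenmanDuminilCopinAnnals2021, arXiv:1912.07973 Prop. 5.3, Prop. 8.6]
[cite: BergChristensenRessel1984, Ch. 4 §6] -/
theorem criticalAxis_completelyMonotone : ∀ (i : Fin 3) (k n : ℕ), 0 ≤ ∑ j ∈ Finset.range (k + 1), (-1 : ℝ) ^ j * (k.choose j : ℝ) * Literature.Probability.LatticeModels.criticalTwoPoint 3 (Pi.single i ((n + j : ℕ) : ℤ)) := by
  intro i k n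
  have hb : ∃ M : ℝ, ∀ m : ℕ, |criticalTwoPoint 3 (Pi.single i (m : ℤ))| ≤ M :=
    ⟨1, fun m => by
      rw [abs_of_nonneg (criticalTwoPoint_nonneg' _)]
      exact criticalTwoPoint_le_one' _⟩
  exact HankelMoment.completelyMonotone_of_hankel_psd_fin
    (g := fun m : ℕ => criticalTwoPoint 3 (Pi.single i (m : ℤ))) hb
    (fun m c => criticalAxis_hankel_zero_nonneg i m c)
    (fun m c => criticalAxis_hankel_one_nonneg i m c) k n

/-- **Domination for the Ising axis profile** (`0 ≤ T ≤ 1`): for every coefficient vector,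
`Σ c_a c_b ⟨σ₀σ_{(a+b+1)e_i}⟩_{β_c} ≤ Σ c_a c_b ⟨σ₀σ_{(a+b)e_i}⟩_{β_c}`.
[cite: AizenmanDuminilCopinAnnals2021, arXiv:1912.07973 Prop. 5.3, Prop. 8.6] -/
theorem criticalAxis_hankel_one_le_zero (i : Fin 3) (m : ℕ) (c : ℕ → ℝ) :
    ∑ a ∈ Finset.range m, ∑ b ∈ Finset.range m,
        c a * c b * criticalTwoPoint 3 (Pi.single i ((a + b + 1 : ℕ) : ℤ)) ≤
      ∑ a ∈ Finset.range m, ∑ b ∈ Finset.range m,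
        c a * c b * criticalTwoPoint 3 (Pi.single i ((a + b : ℕ) : ℤ)) := by
  have hb : ∃ M : ℝ, ∀ m : ℕ, |criticalTwoPoint 3 (Pi.single i (m : ℤ))| ≤ M :=
    ⟨1, fun m => by
      rw [abs_of_nonneg (criticalTwoPoint_nonneg' _)]
      exact criticalTwoPoint_le_one' _⟩
  refine HankelMoment.form_one_le_form_zero (g := fun m : ℕ => criticalTwoPoint 3 (Pi.single i (m : ℤ)))
    hb (fun m c => ?_) (fun m c => ?_) m c
  · simp only [Finset.sum_range]
    exact criticalAxis_hankel_zero_nonneg i m (fun a => c a)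
  · simp only [Finset.sum_range]
    exact criticalAxis_hankel_one_nonneg i m (fun a => c a)

/-! ### 5. The spectral clause of the axis-profile barrier holds for the true profile -/

/-- **The critical axis profile has the Källén–Lehmann / spectral representation of the barrier's
technique class** (registered sub-goal `hasAxisSpectralRepresentation_criticalAxis` of item 1981):
there is a finite measure `μ` on `[0, ∞)` with `⟨σ₀σ_{n e₀}⟩_{β_c} = ∫ e^{-an} dμ(a)` for all `n : ℕ` —
Aizenman–Duminil-Copin 2021 App. Prop. 8.6, PROVED in the tree (`AizenmanDuminilCopin2021_prop_8_6_holds`),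
at `d = 3`, `β = β_c > 0` (`criticalBeta_pos_holds`), `m*(β_c) = 0` (`spontaneousMagnetization_criticalBeta_eq_zero_holds`).
[cite: AizenmanDuminilCopinAnnals2021, arXiv:1912.07973 Appendix §8.3 Prop. 8.6 (= Prop. 5.3)] -/
theorem hasAxisSpectralRepresentation_criticalAxis : Literature.Barriers.CriticalPhenomena.HasAxisSpectralRepresentation (fun n : ℕ => Literature.Probability.LatticeModels.criticalTwoPoint 3 (Pi.single 0 (n : ℤ))) := by
  obtain ⟨μ, hfin, hsupp, hrep⟩ := AizenmanDuminilCopin2021_prop_8_6_holds 2 (criticalBeta (2 + 1))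
    (criticalBeta_pos_holds (d := 2 + 1) (by norm_num))
    (spontaneousMagnetization_criticalBeta_eq_zero_holds (d := 2 + 1) (by norm_num)) 0
  refine ⟨μ, hfin, hsupp, fun n => ?_⟩
  have h := hrep (n : ℤ)
  simp only [Int.cast_natCast, Nat.abs_cast] at h
  exact h

/-- **At the Ising profile, the refuted technique class's instance IS item 6150** (registered sub-goal
`axisProfileDoublingFor_criticalAxis_iff` of item 1981): with `AxisProfileFacts g₀` (p151247) and the
spectral representation (above) both holding for `g₀(n) = ⟨σ₀σ_{n e₀}⟩_{β_c}`,
`AxisProfileDoublingFor g₀ ↔ TwoPointDoubling`; the class's master statement `∀ g, AxisProfileDoublingFor g`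
is false (`Literature.Barriers.CriticalPhenomena.not_forall_axisProfileDoublingFor`, p149925).
[cite: AizenmanDuminilCopinAnnals2021, arXiv:1912.07973 Remark 5.10, §5.6 (p. 20)] -/
theorem axisProfileDoublingFor_criticalAxis_iff : Literature.Barriers.CriticalPhenomena.AxisProfileDoublingFor (fun n : ℕ => Literature.Probability.LatticeModels.criticalTwoPoint 3 (Pi.single 0 (n : ℤ))) ↔ Summit.CriticalPhenomena.Ising3DConformalLimit.Theses.MirrorHoelderCompactness.TwoPointDoubling :=
  ⟨fun h => twoPointDoubling_of_axisProfileDoublingFor h hasAxisSpectralRepresentation_criticalAxis,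
    fun hD _ _ => twoPointDoubling_iff_axisDoubling.1 hD⟩

end Summit.CriticalPhenomena.Ising3DConformalLimit.Cruxes.ExistsScaleCovariantLimit.FoldedCurrentRepulsion

end
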